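import Mathlib.Data.Nat.Choose.Sum
import Mathlib.Data.Real.Basic
import Mathlib.Algebra.Order.BigOperators.Group.Finset
import Mathlib.Order.Interval.Set.Basic
import Mathlib.Tactic.FieldSimp
import Mathlib.Tactic.Linarith
import Mathlib.Tactic.LinearCombination
import Mathlib.Tactic.Positivity
import Mathlib.Tactic.Ring
import HarnessLib

/-!
# Bernstein enclosure of a polynomial on `[0, H]` (the defect bound of the ramp-enclosure kernel;
# `pub-fluidc-bp3/R1-DESIGN.md` §9.2 `hDB`, layer B of `structure Row`)

HONEST FRAMING (cell `pub-fluidc`, blueprint seat bp3, gen 20): low prior, high value-of-information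
experiment on Tao's machine paradigm; NOT a claim that NS blows up. Elementary real algebra.

The kernel of record (`kgen19.py`, `defect_bound`) bounds the reference defect
`d_i(u) = x̂_i'(u) − F_i(x̂(u))`, a polynomial of degree `n = 2·DEG` in the row time `u ∈ [0, H]` with exact
rational coefficients `d_m`, by its BERNSTEIN ENCLOSURE: with `b_j := Σ_{m ≤ j} C(j,m)/C(n,m) · d_m H^m`
(`j ≤ n`), `sup_{[0,H]} |d| ≤ max_j |b_j|` (and `min_j b_j ≤ d ≤ max_j b_j`). This file proves exactly that:
the Bernstein basis functions `B_{j,n}(v) = C(n,j) v^j (1−v)^{n−j}` are nonnegative on `[0,1]` and sum to `1`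
(binomial theorem), monomials expand as `C(n,m) v^m = Σ_j C(j,m) B_{j,n}(v)` (`Nat.choose_mul` and the
binomial theorem again), hence `Σ_m a_m v^m = Σ_j coeff_j · B_{j,n}(v)` with
`coeff_j = Σ_{m ≤ j} C(j,m)/C(n,m) a_m`, and the one- and two-sided enclosures follow; `abs_poly_le_on_Icc`
is the scaled form on `[0, H]` the table layer uses (`a_m = d_m H^m`). The coefficient-sum bound
`Σ |d_m| H^m` it replaces is 10³–10⁶ times weaker on the kernel's rows (R1-DESIGN §7.10).

[cite: Tao2016AveragedNS, §5.5 Thm 5.3 (5.5)]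
-/

noncomputable section

open Finset

namespace Summit.NavierStokesRegularity.FluidComputer

namespace BernsteinEnclosure

/-- The Bernstein basis function `B_{j,n}(v) = C(n,j) v^j (1 − v)^(n − j)`. [folklore] -/
def basisFn (n j : ℕ) (v : ℝ) : ℝ := (n.choose j : ℝ) * v ^ j * (1 - v) ^ (n - j)

/-- The `j`-th Bernstein coefficient (degree `n`) of the coefficient sequence `a`:
`Σ_{m ≤ j} C(j,m)/C(n,m) · a m`. [folklore] -/
def coeff (n : ℕ) (a : ℕ → ℝ) (j : ℕ) : ℝ :=
  ∑ m ∈ range (j + 1), ((j.choose m : ℝ) / (n.choose m : ℝ)) * a m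

/-- `B_{j,n} ≥ 0` on `[0, 1]`. [folklore] -/
theorem basisFn_nonneg (n j : ℕ) {v : ℝ} (h0 : 0 ≤ v) (h1 : v ≤ 1) : 0 ≤ basisFn n j v := by
  unfold basisFn
  have : 0 ≤ 1 - v := by linarith
  positivity

/-- Partition of unity: `Σ_{j ≤ n} B_{j,n}(v) = 1` (binomial theorem). [folklore] -/
theorem sum_basisFn (n : ℕ) (v : ℝ) : ∑ j ∈ range (n + 1), basisFn n j v = 1 := by
  have h := add_pow v (1 - v) n
  rw [show v + (1 - v) = 1 by ring, one_pow] at h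
  rw [h]
  refine Finset.sum_congr rfl fun j _ => ?_
  unfold basisFn
  ring

/-- Monomials in the Bernstein basis: `C(n,m) v^m = Σ_{j ≤ n} C(j,m) B_{j,n}(v)` for `m ≤ n`
(terms with `j < m` vanish). [folklore] -/
theorem choose_mul_pow_eq (n m : ℕ) (hm : m ≤ n) (v : ℝ) :
    (n.choose m : ℝ) * v ^ m = ∑ j ∈ range (n + 1), (j.choose m : ℝ) * basisFn n j v := by
  have hsplit : n + 1 = m + (n - m + 1) := by omega
  rw [hsplit, Finset.sum_range_add]
  have h1 : ∑ j ∈ range m, (j.choose m : ℝ) * basisFn n j v = 0 := by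
    refine Finset.sum_eq_zero fun j hj => ?_
    rw [Nat.choose_eq_zero_of_lt (Finset.mem_range.1 hj), Nat.cast_zero, zero_mul]
  have h2 : ∀ i ∈ range (n - m + 1), ((m + i).choose m : ℝ) * basisFn n (m + i) v
      = (n.choose m : ℝ) * v ^ m * (v ^ i * (1 - v) ^ (n - m - i) * ((n - m).choose i : ℝ)) := by
    intro i hi
    have hc : (n.choose (m + i) : ℝ) * ((m + i).choose m : ℝ)
        = (n.choose m : ℝ) * ((n - m).choose i : ℝ) := by
      have h := Nat.choose_mul (n := n) (k := m + i) (s := m) (Nat.le_add_right m i)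
      rw [Nat.add_sub_cancel_left] at h
      exact_mod_cast h
    have he : n - (m + i) = n - m - i := by omega
    unfold basisFn
    rw [he, pow_add]
    linear_combination (v ^ m * v ^ i * (1 - v) ^ (n - m - i)) * hc
  rw [h1, zero_add, Finset.sum_congr rfl h2, ← Finset.mul_sum, ← add_pow v (1 - v) (n - m),
    show v + (1 - v) = 1 by ring, one_pow, mul_one]

/-- **The Bernstein form**: `Σ_{m ≤ n} a_m v^m = Σ_{j ≤ n} coeff_j · B_{j,n}(v)`. [folklore] -/
theorem poly_eq_sum_coeff_basisFn (n : ℕ) (a : ℕ → ℝ) (v : ℝ) :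
    ∑ m ∈ range (n + 1), a m * v ^ m = ∑ j ∈ range (n + 1), coeff n a j * basisFn n j v := by
  have hext : ∀ j ∈ range (n + 1), coeff n a j * basisFn n j v
      = ∑ m ∈ range (n + 1), ((j.choose m : ℝ) / (n.choose m : ℝ)) * a m * basisFn n j v := by
    intro j hj
    have hj' : j + 1 ≤ n + 1 := Nat.succ_le_of_lt (Finset.mem_range.1 hj)
    unfold coeff
    rw [Finset.sum_mul]
    apply Finset.sum_subset (Finset.range_subset_range.2 hj')
    intro m _ hm'
    have hlt : j < m := by
      rw [Finset.mem_range, not_lt] at hm'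
      omega
    rw [Nat.choose_eq_zero_of_lt hlt, Nat.cast_zero, zero_div, zero_mul, zero_mul]
  rw [Finset.sum_congr rfl hext, Finset.sum_comm]
  refine Finset.sum_congr rfl fun m hm => ?_
  have hmn : m ≤ n := Nat.lt_succ_iff.mp (Finset.mem_range.1 hm)
  have hc0 : (n.choose m : ℝ) ≠ 0 := by exact_mod_cast (Nat.choose_pos hmn).ne'
  have hmono := choose_mul_pow_eq n m hmn v
  calc a m * v ^ m = a m / (n.choose m : ℝ) * ((n.choose m : ℝ) * v ^ m) := by
        field_simp
    _ = a m / (n.choose m : ℝ) * ∑ j ∈ range (n + 1), (j.choose m : ℝ) * basisFn n j v := by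
        rw [hmono]
    _ = ∑ j ∈ range (n + 1), (j.choose m : ℝ) / (n.choose m : ℝ) * a m * basisFn n j v := by
        rw [Finset.mul_sum]
        refine Finset.sum_congr rfl fun j _ => ?_
        ring

/-- One-sided enclosure from above: all `coeff_j ≤ M` ⇒ `Σ a_m v^m ≤ M` on `[0, 1]`. [folklore] -/
theorem poly_le_of_coeff_le {n : ℕ} {a : ℕ → ℝ} {M v : ℝ} (h0 : 0 ≤ v) (h1 : v ≤ 1)
    (hM : ∀ j ≤ n, coeff n a j ≤ M) : ∑ m ∈ range (n + 1), a m * v ^ m ≤ M := by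
  rw [poly_eq_sum_coeff_basisFn]
  calc ∑ j ∈ range (n + 1), coeff n a j * basisFn n j v
      ≤ ∑ j ∈ range (n + 1), M * basisFn n j v :=
        Finset.sum_le_sum fun j hj => mul_le_mul_of_nonneg_right
          (hM j (Nat.lt_succ_iff.mp (Finset.mem_range.1 hj))) (basisFn_nonneg n j h0 h1)
    _ = M := by rw [← Finset.mul_sum, sum_basisFn, mul_one]

/-- One-sided enclosure from below: all `L ≤ coeff_j` ⇒ `L ≤ Σ a_m v^m` on `[0, 1]`. [folklore] -/
theorem le_poly_of_le_coeff {n : ℕ} {a : ℕ → ℝ} {L v : ℝ} (h0 : 0 ≤ v) (h1 : v ≤ 1)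
    (hL : ∀ j ≤ n, L ≤ coeff n a j) : L ≤ ∑ m ∈ range (n + 1), a m * v ^ m := by
  rw [poly_eq_sum_coeff_basisFn]
  calc L = ∑ j ∈ range (n + 1), L * basisFn n j v := by
        rw [← Finset.mul_sum, sum_basisFn, mul_one]
    _ ≤ ∑ j ∈ range (n + 1), coeff n a j * basisFn n j v :=
        Finset.sum_le_sum fun j hj => mul_le_mul_of_nonneg_right
          (hL j (Nat.lt_succ_iff.mp (Finset.mem_range.1 hj))) (basisFn_nonneg n j h0 h1)

/-- Two-sided enclosure: all `|coeff_j| ≤ M` ⇒ `|Σ a_m v^m| ≤ M` on `[0, 1]`. [folklore] -/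
theorem abs_poly_le_of_coeff {n : ℕ} {a : ℕ → ℝ} {M v : ℝ} (h0 : 0 ≤ v) (h1 : v ≤ 1)
    (hM : ∀ j ≤ n, |coeff n a j| ≤ M) : |∑ m ∈ range (n + 1), a m * v ^ m| ≤ M := by
  rw [abs_le]
  refine ⟨le_poly_of_le_coeff h0 h1 fun j hj => (abs_le.1 (hM j hj)).1,
    poly_le_of_coeff_le h0 h1 fun j hj => (abs_le.1 (hM j hj)).2⟩

/-- **The kernel's defect bound** (scaled form on `[0, H]`, `0 < H`): with
`b_j = Σ_{m ≤ j} C(j,m)/C(n,m) · d_m H^m`, all `|b_j| ≤ M` ⇒ `|Σ_{m ≤ n} d_m u^m| ≤ M` for `u ∈ [0, H]`.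
[folklore] -/
theorem abs_poly_le_on_Icc {n : ℕ} {d : ℕ → ℝ} {H M : ℝ} (hH : 0 < H)
    (hM : ∀ j ≤ n, |coeff n (fun m => d m * H ^ m) j| ≤ M) {u : ℝ} (hu : u ∈ Set.Icc 0 H) :
    |∑ m ∈ range (n + 1), d m * u ^ m| ≤ M := by
  have hv0 : 0 ≤ u / H := div_nonneg hu.1 hH.le
  have hv1 : u / H ≤ 1 := (div_le_one hH).2 hu.2
  have h := abs_poly_le_of_coeff hv0 hv1 hM
  have heq : ∑ m ∈ range (n + 1), d m * H ^ m * (u / H) ^ m = ∑ m ∈ range (n + 1), d m * u ^ m := by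
    refine Finset.sum_congr rfl fun m _ => ?_
    rw [div_pow, mul_assoc, mul_div_cancel₀ _ (pow_ne_zero m hH.ne')]
  rwa [heq] at h

/-- One-sided scaled forms on `[0, H]`: `min_j b_j ≤ Σ d_m u^m ≤ max_j b_j`. [folklore] -/
theorem poly_mem_Icc_on_Icc {n : ℕ} {d : ℕ → ℝ} {H L M : ℝ} (hH : 0 < H)
    (hL : ∀ j ≤ n, L ≤ coeff n (fun m => d m * H ^ m) j)
    (hM : ∀ j ≤ n, coeff n (fun m => d m * H ^ m) j ≤ M) {u : ℝ} (hu : u ∈ Set.Icc 0 H) :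
    ∑ m ∈ range (n + 1), d m * u ^ m ∈ Set.Icc L M := by
  have hv0 : 0 ≤ u / H := div_nonneg hu.1 hH.le
  have hv1 : u / H ≤ 1 := (div_le_one hH).2 hu.2
  have heq : ∑ m ∈ range (n + 1), d m * H ^ m * (u / H) ^ m = ∑ m ∈ range (n + 1), d m * u ^ m := by
    refine Finset.sum_congr rfl fun m _ => ?_
    rw [div_pow, mul_assoc, mul_div_cancel₀ _ (pow_ne_zero m hH.ne')]
  rw [← heq]
  exact ⟨le_poly_of_le_coeff hv0 hv1 hL, poly_le_of_coeff_le hv0 hv1 hM⟩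

end BernsteinEnclosure

end Summit.NavierStokesRegularity.FluidComputer
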